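import Summits.CriticalPhenomena.PercolationContinuityZ3.Theorems.Transplant.KNCellsScheme
import HarnessLib

/-!
# F8 (generic), part 2 — the anchored exploration process as a history-driven site scheme: replay with anchors, validity, the scheme
# (BLUEPRINT-I-PHI §3 Φ11; generalises `L/KozmaNitzanScheme.lean` ll. 976–1027 with the anchor maps of HOME/prim-bschramm-p2-g2/F8-DESIGN.md)

builds on p205010 (kernel theorem, internal audit signed; external expert review pending) — nothing in this file uses p205010.
Lane `prim-bschramm`, seat `prim-bschramm-p2` (task F8); helper file (`--supports stmt-CriticalPhenomena-4575`).  Continuation of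
`KNCellsScheme` (anchored cells `CellGeom`, the examination `succA`/`probe` at a source anchor).

* `probe h e a` — the adaptive probe of the examination along `e` at source anchor `a` (locality from part 1);
* `astOf` — REPLAY WITH ANCHORS (newest entry first, mirroring `HSiteScheme.mstOf`): the macro-state together with the arrival / departure
  anchors of the macro-vertices; a recorded probe examines the chosen edge at the source's departure anchor, occupies or blocks the target,
  and sets the target's arrival anchor (:= the source's departure anchor) and departure anchor (read off the record by `depA`);
* `succ h e o := succA h e (dep e.1) o` and **`mst_eq_astOf`**: the `HSiteScheme` replay from `succ` is the macro part of `astOf`;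
* `W₀` ((32)'s weighting), `Valid` (anchored (29), (31), (32): pattern facts, root and source column explored, explored region inside the
  anchored `Cover` of determined vertices missing the target and its onward neighbours, and `P(root ↔ M_v in E_i ∪ E_{w,v} | ω|_{E_i}) > 1 - δ`),
  `nextProbe`, `scheme : HSiteScheme V`, `scheme_mst`, `nextProbe_eq_some`, `nextProbe_of_valid`.

[cite: KozmaNitzan2024, §4 pp. 25–29 ((29), (31), (32)) — the ℤ^d model] [cite: GrimmettPercolation1999, §7.2]
-/

noncomputable section

open MeasureTheory ProbabilityTheory
open scoped ENNReal Classical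

namespace Summit.CriticalPhenomena.PercolationContinuityZ3.Theorems

namespace Transplant

namespace KNCells

open Literature.Probability.Percolation Literature.Probability.LatticeModels SimpleGraph GadgetSystem ProbeHistory

variable {V : Type*} [DecidableEq V]

namespace KSchA

variable {A : Type*} {G : SimpleGraph V} [G.LocallyFinite] (S : KSchA V A)

/-! ## The probe -/

variable (G) in
/-- **The adaptive probe of the examination of `v = tgt e` from `e.1`** at source anchor `a` (reveals `E_{w,v}` and the stubs `H^{j_x}_{v,x}`
at the departure anchor, computing anchor and levels from what it sees). [cite: KozmaNitzan2024, §4 p. 27] -/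
def probe (h : ProbeHistory V) (e : Site 2 × MDir) (a : A) : AProbe V where
  env := S.env G h e a
  reveal := fun ω => S.revealOf G h e a (obs ω (S.env G h e a))
  reveal_subset := fun ω => S.revealOf_subset_env h e a _
  reveal_local := by
    intro ω ω' hag
    refine S.revealOf_congr fun x hx => ?_
    have hxe : x ∈ S.env G h e a := S.revealOf_subset_env h e a _ hx
    simp only [mem_obs_iff, hxe, true_and]
    exact hag x hx

/-- The observation of the probe agrees with the observation of the envelope on the revealed edges, so success read off either is the
same. [folklore] -/
theorem succA_read_iff (h : ProbeHistory V) (e : Site 2 × MDir) (a : A) (ω : BondConfig V) :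
    S.succA G h e a ((S.probe G h e a).read ω) ↔ S.succA G h e a (obs ω (S.env G h e a)) := by
  refine S.succA_congr fun x hx => ?_
  have hxe : x ∈ S.env G h e a := S.revealOf_subset_env h e a _ hx
  simp only [AProbe.read, probe, mem_obs_iff, hxe, hx, true_and]

/-! ## §4 The anchored replay, validity and the scheme -/

/-- The replayed state with anchors: the macro-state and the arrival / departure anchors of the macro-vertices (junk values off the
determined / occupied ones). [cite: KozmaNitzan2024, §4 pp. 25–27] -/
structure AState (A : Type*) where
  /-- the macro-state (occupied / blocked) -/
  st : HSiteScheme.HState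
  /-- arrival anchors -/
  arr : Site 2 → A
  /-- departure anchors -/
  dep : Site 2 → A

variable (G) in
/-- **Replay with anchors** (newest entry first, mirroring `HSiteScheme.mstOf`): a recorded probe is the examination along the chosen edge
`e` of the state replayed from the older part, at the source's departure anchor `a`; it occupies the target iff `succA … a` holds, blocks it
otherwise, and sets the target's arrival anchor to `a` and its departure anchor to the one read off the record.
[cite: KozmaNitzan2024, §4 pp. 25–27] -/
def astOf : ProbeHistory V → AState A
  | [] => ⟨HSiteScheme.HState.start, fun _ => S.Γ.a₀, fun _ => S.Γ.a₀⟩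
  | none :: h => astOf h
  | some r :: h =>
    match (astOf h).st.choice with
    | none => astOf h
    | some e =>
      ⟨(astOf h).st.update e (S.succA G h e ((astOf h).dep e.1) r.2),
        Function.update (astOf h).arr (tgt e) ((astOf h).dep e.1),
        Function.update (astOf h).dep (tgt e) (S.depA G h e ((astOf h).dep e.1) r.2)⟩

variable (G) in
/-- **Success** of the probe made after `h` along `e`, reading `o`: success at the replayed departure anchor of the source.
[cite: KozmaNitzan2024, §4 p. 27] -/
def succ (h : ProbeHistory V) (e : Site 2 × MDir) (o : Finset (Sym2 V)) : Prop := S.succA G h e ((S.astOf G h).dep e.1) o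

/-- Replay of the empty history. [folklore] -/
@[simp] theorem astOf_nil : S.astOf G [] = ⟨HSiteScheme.HState.start, fun _ => S.Γ.a₀, fun _ => S.Γ.a₀⟩ := rfl

/-- A `none` step does not change the replayed state. [folklore] -/
@[simp] theorem astOf_cons_none (h : ProbeHistory V) : S.astOf G (none :: h) = S.astOf G h := rfl

/-- A recorded probe updates the chosen edge, if any, and sets the target's anchors. [folklore] -/
theorem astOf_cons_some (r : ProbeRecord V) (h : ProbeHistory V) :
    S.astOf G (some r :: h) = (match (S.astOf G h).st.choice with
      | none => S.astOf G h
      | some e =>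
        ⟨(S.astOf G h).st.update e (S.succA G h e ((S.astOf G h).dep e.1) r.2),
          Function.update (S.astOf G h).arr (tgt e) ((S.astOf G h).dep e.1),
          Function.update (S.astOf G h).dep (tgt e) (S.depA G h e ((S.astOf G h).dep e.1) r.2)⟩) := rfl

/-- **The macro-state replayed by the `HSiteScheme` machinery from `succ` is the macro part of the anchored replay.** [folklore] -/
theorem mst_eq_astOf : ∀ h : ProbeHistory V, HSiteScheme.mstOf (S.succ G) h = (S.astOf G h).st
  | [] => rfl
  | none :: h => by rw [HSiteScheme.mstOf_cons_none, astOf_cons_none]; exact mst_eq_astOf h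
  | some r :: h => by
    rw [HSiteScheme.mstOf_cons_some, mst_eq_astOf h, astOf_cons_some]
    cases (S.astOf G h).st.choice <;> rfl

variable (G) in
/-- The weighting of (32): pinned on `ω|_{E_i}`, restricted to `E_i ∪ E_{w,v}`. [cite: KozmaNitzan2024, §4 p. 28 ((32))] -/
def W₀ (h : ProbeHistory V) (e : Site 2 × MDir) (a : A) : Sym2 V → unitInterval :=
  restrW (↑(S.Vx G h ∪ S.Γ.Ewv a e.1 e.2) : Set V) (pinW (KNLevels.lattW G S.p) ↑(S.F G h) ↑(S.ξ G h))

variable (G) in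
/-- **Valid histories** for the examination along `e` (anchored (29), (31), (32)): the explored edges are the edges of `G` inside the explored
region and carry the pattern, the root is explored, the source's column is explored, the explored region lies in the anchored cover of a set of
determined macro-vertices missing the target and its onward neighbours, and the estimate (32) holds at the source's departure anchor:
`P(root ↔ M_v in E_i ∪ E_{w,v} | ω|_{E_i}) > 1 - δ`. [cite: KozmaNitzan2024, §4 pp. 26–28 ((29), (31), (32))] -/
structure Valid (h : ProbeHistory V) (e : Site 2 × MDir) : Prop where
  F_eq : S.F G h = edgesIn G (S.Vx G h)
  ξ_sub : S.ξ G h ⊆ S.F G h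
  root_mem : S.Γ.root ∈ S.Vx G h
  src_mem : ∃ y ∈ S.Vx G h, y ∈ S.Γ.col e.1
  cover : ∃ det : Set (Site 2), tgt e ∉ det ∧ (∀ du ∈ S.onward G h (tgt e), tgt e + stepVec du ∉ det) ∧
    (↑(S.Vx G h) : Set V) ⊆ S.Γ.Cover (S.astOf G h).arr (S.astOf G h).dep det
  reach : 1 - S.δc < (prodBernoulli (S.W₀ G h e ((S.astOf G h).dep e.1))).real
    (⋃ t ∈ S.Γ.M ((S.astOf G h).dep e.1) (tgt e), openConn S.Γ.root t)

variable (G) in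
/-- The next probe: examine the chosen candidate at the source's departure anchor, but only after a valid history.
[cite: KozmaNitzan2024, §4 p. 27] -/
def nextProbe (h : ProbeHistory V) : Option (AProbe V) :=
  match (S.astOf G h).st.choice with
  | none => none
  | some e => if S.Valid G h e then some (S.probe G h e ((S.astOf G h).dep e.1)) else none

variable (G) in
/-- **The anchored exploration process** as a history-driven site scheme. [cite: KozmaNitzan2024, §4 pp. 26–27] -/
def scheme : HSiteScheme V := ⟨⟨S.nextProbe G⟩, S.U₀ G, S.succ G⟩

/-- The scheme's macro-state is the macro part of the anchored replay. [folklore] -/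
theorem scheme_mst (h : ProbeHistory V) : (S.scheme G).mst h = (S.astOf G h).st := S.mst_eq_astOf h

/-- If a probe is made, the history is valid for the chosen edge and the probe is the examination at the source's departure anchor. [folklore] -/
theorem nextProbe_eq_some {h : ProbeHistory V} {P : AProbe V} (hP : S.nextProbe G h = some P) :
    ∃ e, (S.astOf G h).st.choice = some e ∧ S.Valid G h e ∧ P = S.probe G h e ((S.astOf G h).dep e.1) := by
  unfold nextProbe at hP
  cases hc : (S.astOf G h).st.choice with
  | none => rw [hc] at hP; simp at hP
  | some e =>
    rw [hc] at hP
    simp only at hP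
    split_ifs at hP with hV
    rw [Option.some.injEq] at hP
    exact ⟨e, rfl, hV, hP.symm⟩

/-- Conversely a valid history with a candidate is probed. [folklore] -/
theorem nextProbe_of_valid {h : ProbeHistory V} {e : Site 2 × MDir}
    (hc : (S.astOf G h).st.choice = some e) (hV : S.Valid G h e) :
    S.nextProbe G h = some (S.probe G h e ((S.astOf G h).dep e.1)) := by
  unfold nextProbe; rw [hc]; simp only; rw [if_pos hV]

end KSchA

end KNCells

end Transplant

end Summit.CriticalPhenomena.PercolationContinuityZ3.Theorems

end
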